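import Summits.CriticalPhenomena.PercolationContinuityZ3.Theorems.PercAnnulusCrossingSlabCrossingBridgeCritical
import Literature.Probability.Percolation.SlabBoxCrossingPropertyOfRSW
import Literature.Probability.Percolation.SlabBoxCrossingPropertyCorollaries
import Literature.Probability.Percolation.SlabRSWTheorem314
import Literature.Probability.Percolation.AizenmanGrimmett1991.SlabCriticalPointChain
import Literature.Probability.Percolation.CriticalContinuityProofs
import HarnessLib

/-!
# RSW3 lane (lead GEN 36): THE ASSEMBLY OF NEWMAN–TASSION–WU'S THEOREM 3.1 AT `p_c(S_k)` — what is in the tree reduces the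
# box-crossing property of the critical slab to TWO named inputs: the RSW Theorem 3.14 at `p_c(S_k)` and the upper bound (3.60)

builds on p205010 (kernel theorem, internal audit signed; external expert review pending) — NOT used in this file.

Cell `prim-rsw3` (LANE 3), lead seat, gen 36.  Support file (`--supports stmt-CriticalPhenomena-4575`); no definitions, no named
facts, no sorries.  With the pieces landed this generation — the bridge (`…SlabCrossingBridge{,Critical}`: NTW's hypothesis (3.38)
`inf_n f(n,2n) ≥ 1/25` at `p_c(S_k)`), the §3.7 glue `NTW17.boxCrossingProperty_of_rsw` ((3.59) ∧ (3.60) ⇒ box-crossing property),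
and `0 < p_c(ℤ³) < p_c(S_k) ≤ 1/2` (Aizenman–Grimmett; the lane's `Transplant.StairSlabLog.criticalProb_slab_le_half`) — the named fact
`NewmanTassionWu2017_thm31` is reduced to exactly two inputs per thickness `k ≥ 1`, stated here as hypotheses IN FINAL FORM:

* `(H314)` NTW's RSW THEOREM 3.14 at `p = p_c(S_k)`: `(∀ n ≥ 1, c₀ ≤ f(n,2n)) → ∃ c₁ > 0, ∀ n ≥ 1, c₁ ≤ f(2n,n)` — of which Lemma 3.15,
  Case 1 and the closing step are in the tree (`NTW17.lemma315`, `NTW17.case1_of_B1`, `NTW17.hardWay_of_f28_14`); Cases 2–3 need the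
  port's Layer 1b (GL with `S ⊊ R`; the exploration step and Lemma 3.16);
* `(H360)` the UPPER BOUND (3.60) at `p_c(S_k)`: `∃ c₂ > 0, ∀ n ≥ 1, f(n,2n) ≤ 1 - c₂` — NTW's Lemma 3.13(i) (`f(2n,n-1) ≤ 1 - c₁`, via
  Lemma 3.11 = Thm 3.8/3.10 + 1-independent renormalisation) with Prop. 3.9 and the high-probability RSW Theorem 3.17.

* `boxCrossingProperty_slabCritical_of` — `(H314) → (H360) → NTW17.BoxCrossingProperty k (p_c(S_k))` for `k ≥ 1`;
* `NewmanTassionWu2017_thm31_of` — the `k`-quantified form: `(∀ k ≥ 1, H314_k) → (∀ k ≥ 1, H360_k) → NewmanTassionWu2017_thm31`;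
* `oneArm_decay_slabCritical_of` — under the same two inputs, Cor. 3.2 (iii) at `p_c(S_k)` (polynomial one-arm decay), unconditionally
  in the named fact.

References: C. M. Newman, V. Tassion, W. Wu, *Critical percolation and the minimal spanning tree in slabs*, Comm. Pure Appl. Math. 70
(2017) = arXiv:1512.09107, §3.7 (proof of Theorem 3.1), Theorems 3.14, 3.17, Lemma 3.13 [NewmanTassionWu2017]; G. Grimmett,
*Percolation* (1999), §7.3 p. 165 (`p_c(S_k) > p_c`) [GrimmettPercolation1999].
-/

noncomputable section

namespace Summit.CriticalPhenomena.PercolationContinuityZ3.Theorems.Crossing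

open MeasureTheory
open Literature.Probability.Percolation Literature.Probability.LatticeModels
open Literature.Probability.Percolation.NTW17

/-- **NTW's Theorem 3.1 at `p_c(S_k)`, reduced to Theorem 3.14 and the upper bound (3.60).**  For `k ≥ 1`: if (H314) the RSW
Theorem 3.14 holds at `p = p_c(S_k)` (for the input constant `c₀ = 1/25`, which the tree supplies: `le_real_slabConn_slabCritical`) and
(H360) `f_{p_c(S_k)}(n,2n) ≤ 1 - c₂` for all `n ≥ 1`, then the box-crossing property holds at `p_c(S_k)`.
[cite: NewmanTassionWu2017, §3.7 (proof of Theorem 3.1)] -/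
theorem boxCrossingProperty_slabCritical_of (k : ℕ) (hk : 1 ≤ k)
    (h314 : (∀ n : ℕ, 1 ≤ n → (1 : ℝ) / 25 ≤
        (bondPercolation (slabGraph 3 k) (criticalProbIOf (slabGraph 3 k) (slabOrigin 3 k))).real
          (slabConn k (boxR 0 n 0 (2 * n)) {z | z.1 = 0} {z | z.1 = n})) →
      ∃ c₁ : ℝ, 0 < c₁ ∧ ∀ n : ℕ, 1 ≤ n → c₁ ≤
        (bondPercolation (slabGraph 3 k) (criticalProbIOf (slabGraph 3 k) (slabOrigin 3 k))).real
          (slabConn k (boxR 0 (2 * n) 0 n) {z | z.1 = 0} {z | z.1 = 2 * n}))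
    (h360 : ∃ c₂ : ℝ, 0 < c₂ ∧ ∀ n : ℕ, 1 ≤ n →
      (bondPercolation (slabGraph 3 k) (criticalProbIOf (slabGraph 3 k) (slabOrigin 3 k))).real
        (slabConn k (boxR 0 n 0 (2 * n)) {z | z.1 = 0} {z | z.1 = n}) ≤ 1 - c₂) :
    BoxCrossingProperty k (criticalProbIOf (slabGraph 3 k) (slabOrigin 3 k)) := by
  -- `0 < p_c(ℤ³) < p_c(S_k) ≤ 1/2`
  have hpos : 0 < ((criticalProbIOf (slabGraph 3 k) (slabOrigin 3 k) : unitInterval) : ℝ) := by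
    show 0 < criticalProb (slabGraph 3 k) (slabOrigin 3 k)
    exact (criticalProb_zd_pos 3 (by norm_num)).trans (AizenmanGrimmett1991.criticalProb_zd_lt_criticalProb_slab_of_AG (d := 3) le_rfl k)
  have hlt : ((criticalProbIOf (slabGraph 3 k) (slabOrigin 3 k) : unitInterval) : ℝ) < 1 := by
    show criticalProb (slabGraph 3 k) (slabOrigin 3 k) < 1
    exact (Transplant.StairSlabLog.criticalProb_slab_le_half k).trans_lt (by norm_num)
  -- (3.38) at `p_c(S_k)`, then Theorem 3.14, then the §3.7 glue
  have h338 : ∀ n : ℕ, 1 ≤ n → (1 : ℝ) / 25 ≤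
      (bondPercolation (slabGraph 3 k) (criticalProbIOf (slabGraph 3 k) (slabOrigin 3 k))).real
        (slabConn k (boxR 0 n 0 (2 * n)) {z | z.1 = 0} {z | z.1 = n}) :=
    fun n _ => le_real_slabConn_slabCritical k n
  exact boxCrossingProperty_of_rsw hk (ρ₀ := 4) le_rfl _ hpos hlt (h314 h338) h360

/-- **`NewmanTassionWu2017_thm31` from its two remaining inputs**, for every thickness: if for every `k ≥ 1` the RSW Theorem 3.14
holds at `p_c(S_k)` (input `c₀ = 1/25`) and the upper bound (3.60) holds at `p_c(S_k)`, then NTW's Theorem 3.1 holds (the named fact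
is discharged modulo these two). [cite: NewmanTassionWu2017, Theorem 3.1 and §3.7] -/
theorem NewmanTassionWu2017_thm31_of
    (h314 : ∀ k : ℕ, 1 ≤ k →
      (∀ n : ℕ, 1 ≤ n → (1 : ℝ) / 25 ≤
        (bondPercolation (slabGraph 3 k) (criticalProbIOf (slabGraph 3 k) (slabOrigin 3 k))).real
          (slabConn k (boxR 0 n 0 (2 * n)) {z | z.1 = 0} {z | z.1 = n})) →
      ∃ c₁ : ℝ, 0 < c₁ ∧ ∀ n : ℕ, 1 ≤ n → c₁ ≤
        (bondPercolation (slabGraph 3 k) (criticalProbIOf (slabGraph 3 k) (slabOrigin 3 k))).real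
          (slabConn k (boxR 0 (2 * n) 0 n) {z | z.1 = 0} {z | z.1 = 2 * n}))
    (h360 : ∀ k : ℕ, 1 ≤ k → ∃ c₂ : ℝ, 0 < c₂ ∧ ∀ n : ℕ, 1 ≤ n →
      (bondPercolation (slabGraph 3 k) (criticalProbIOf (slabGraph 3 k) (slabOrigin 3 k))).real
        (slabConn k (boxR 0 n 0 (2 * n)) {z | z.1 = 0} {z | z.1 = n}) ≤ 1 - c₂) :
    NewmanTassionWu2017_thm31 :=
  fun k hk => boxCrossingProperty_slabCritical_of k hk (h314 k hk) (h360 k hk)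

/-- **Cor. 3.2 (iii) at `p_c(S_k)` from the same two inputs** (polynomial decay of the one-arm probability of the critical slab,
`P_{p_c(S_k)}[B̄_m ⟷^{B̄_n} ∂B̄_n] ≤ C ((m+1)/(n+1))^δ`), without the named fact. [cite: NewmanTassionWu2017, Corollary 3.2 (iii)] -/
theorem oneArm_decay_slabCritical_of (k : ℕ) (hk : 1 ≤ k)
    (h314 : (∀ n : ℕ, 1 ≤ n → (1 : ℝ) / 25 ≤
        (bondPercolation (slabGraph 3 k) (criticalProbIOf (slabGraph 3 k) (slabOrigin 3 k))).real
          (slabConn k (boxR 0 n 0 (2 * n)) {z | z.1 = 0} {z | z.1 = n})) →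
      ∃ c₁ : ℝ, 0 < c₁ ∧ ∀ n : ℕ, 1 ≤ n → c₁ ≤
        (bondPercolation (slabGraph 3 k) (criticalProbIOf (slabGraph 3 k) (slabOrigin 3 k))).real
          (slabConn k (boxR 0 (2 * n) 0 n) {z | z.1 = 0} {z | z.1 = 2 * n}))
    (h360 : ∃ c₂ : ℝ, 0 < c₂ ∧ ∀ n : ℕ, 1 ≤ n →
      (bondPercolation (slabGraph 3 k) (criticalProbIOf (slabGraph 3 k) (slabOrigin 3 k))).real
        (slabConn k (boxR 0 n 0 (2 * n)) {z | z.1 = 0} {z | z.1 = n}) ≤ 1 - c₂) :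
    ∃ C δ : ℝ, 0 < C ∧ 0 < δ ∧ ∀ m n : ℕ, 1 ≤ m → m ≤ n →
      (bondPercolation (slabGraph 3 k) (criticalProbIOf (slabGraph 3 k) (slabOrigin 3 k))).real
        (slabConn k (sqBox 0 n) (sqBox 0 m) (sqSphere 0 n)) ≤ C * (((m : ℝ) + 1) / ((n : ℝ) + 1)) ^ δ :=
  (boxCrossingProperty_slabCritical_of k hk h314 h360).oneArm_decay

/-- **NTW's Theorem 3.1 at `p_c(S_k)` from the THREE-CASE inputs of Theorem 3.14 and the upper bound (3.60).**  For `k ≥ 1`: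
given ANY events `𝓑₂ n` with the Case-2 input (H2) (GL, Thm 3.7: `x ≤ P[𝓑₂ n] ⇒ y ≤ P[𝓑₁ n]` eventually) and the Case-3 input (H3)
(exploration + Lemma 3.16: `x ≤ P[𝒜 n ∩ (𝓑₁ n)ᶜ ∩ (𝓑₂ n)ᶜ] ⇒ y ≤ f(14n,13n)` eventually) at `p = p_c(S_k)`, and (H360)
`f_{p_c(S_k)}(n,2n) ≤ 1 - c₂` for `n ≥ 1`, the box-crossing property holds at `p_c(S_k)` — `NTW17.thm314_of_cases` with the input
(3.38) supplied by `le_real_slabConn_slabCritical` (`c₀ = 1/25`), then `boxCrossingProperty_slabCritical_of`.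
[cite: NewmanTassionWu2017, Theorem 3.1, Theorem 3.14 and §3.7] -/
theorem boxCrossingProperty_slabCritical_of_cases (k : ℕ) (hk : 1 ≤ k)
    (B₂ : ℕ → Set (BondConfig (slab 3 k)))
    (hCase2 : ∀ x : ℝ, 0 < x → ∃ y : ℝ, 0 < y ∧ ∃ n₂ : ℕ, ∀ n : ℕ, n₂ ≤ n →
      x ≤ (bondPercolation (slabGraph 3 k) (criticalProbIOf (slabGraph 3 k) (slabOrigin 3 k))).real (B₂ n) →
      y ≤ (bondPercolation (slabGraph 3 k) (criticalProbIOf (slabGraph 3 k) (slabOrigin 3 k))).real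
        (slabConn k (boxR (-(7 * n)) (7 * n) 0 (13 * n - 1)) (sideSeg (7 * n) (5 * n) (13 * n - 1)) (sideSeg (7 * n) 0 (4 * n - 1))))
    (hCase3 : ∀ x : ℝ, 0 < x → ∃ y : ℝ, 0 < y ∧ ∃ n₃ : ℕ, ∀ n : ℕ, n₃ ≤ n →
      x ≤ (bondPercolation (slabGraph 3 k) (criticalProbIOf (slabGraph 3 k) (slabOrigin 3 k))).real
        ((slabConn k (boxR 0 (7 * n) 0 (8 * n - 1)) {z | z.1 = 0} (sideSeg (7 * n) 0 (4 * n - 1)) ∩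
            slabConn k (boxR (-(7 * n)) (7 * n) 0 (13 * n - 1)) {z | z.2 = 0} (sideSeg (7 * n) (5 * n) (13 * n - 1))) ∩
          (slabConn k (boxR (-(7 * n)) (7 * n) 0 (13 * n - 1)) (sideSeg (7 * n) (5 * n) (13 * n - 1))
            (sideSeg (7 * n) 0 (4 * n - 1)))ᶜ ∩ (B₂ n)ᶜ) →
      y ≤ (bondPercolation (slabGraph 3 k) (criticalProbIOf (slabGraph 3 k) (slabOrigin 3 k))).real
        (slabConn k (boxR 0 (14 * n) 0 (13 * n)) {z | z.1 = 0} {z | z.1 = 14 * n}))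
    (h360 : ∃ c₂ : ℝ, 0 < c₂ ∧ ∀ n : ℕ, 1 ≤ n →
      (bondPercolation (slabGraph 3 k) (criticalProbIOf (slabGraph 3 k) (slabOrigin 3 k))).real
        (slabConn k (boxR 0 n 0 (2 * n)) {z | z.1 = 0} {z | z.1 = n}) ≤ 1 - c₂) :
    BoxCrossingProperty k (criticalProbIOf (slabGraph 3 k) (slabOrigin 3 k)) := by
  have hpos : 0 < ((criticalProbIOf (slabGraph 3 k) (slabOrigin 3 k) : unitInterval) : ℝ) := by
    show 0 < criticalProb (slabGraph 3 k) (slabOrigin 3 k)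
    exact (criticalProb_zd_pos 3 (by norm_num)).trans (AizenmanGrimmett1991.criticalProb_zd_lt_criticalProb_slab_of_AG (d := 3) le_rfl k)
  have hlt : ((criticalProbIOf (slabGraph 3 k) (slabOrigin 3 k) : unitInterval) : ℝ) < 1 := by
    show criticalProb (slabGraph 3 k) (slabOrigin 3 k) < 1
    exact (Transplant.StairSlabLog.criticalProb_slab_le_half k).trans_lt (by norm_num)
  refine boxCrossingProperty_slabCritical_of k hk (fun h338 => ?_) h360
  exact thm314_of_cases hk (ρ := 4) le_rfl _ hpos hlt (c₀ := 1 / 25) (by norm_num) (by norm_num) h338 B₂ hCase2 hCase3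

end Summit.CriticalPhenomena.PercolationContinuityZ3.Theorems.Crossing

end
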